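import Summits.ValiantsHypothesis.ValiantsHypothesis.Theses.TameSensitivity

/-!
# `TameSensitivity.Assembly` holds (bookkeeping item 23475 closed by proof)

The assembly item of route `TameSensitivity` (decomp-valiant workshop cycle 1 = VALIANT, lens 6
«restricted-models lifting axis», OR-sibling of the writer's file `DecompCycle1`) is the implication

  `SensitiveHardPoly → QuantHrubesPer → SmallConstPer → TameGrowth → ValiantsHypothesis`

and is a BINDER of the route's certified deciding theorem `closes` (D-0027 §2.1).  It is proved here
— verbatim port of `closes_tame` from the lens node file
`run/shared/lean/pub/decomp-valiant/decomp-val-lens-6/TameSensitivity.lean` (lean check rc 0 at birth,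
2026-08-29T18:02Z) — so that no decorative item remains open on the route (workshop critic, bus 527,
2026-08-30T07:57:31Z, principle (i)).  The route's open content is unchanged: the cruxes
`SmallConstPer` (item 23471, IDEA-NEEDED: collapse ⇒ small constants for `per`) and `SensitiveHardPoly`
(item 23472, ATTACKABLE: budgeted ε-sensitive monotone hardness of `per`), and the provable-now supports
`QuantHrubesPer` (item 23473, Hrubeš's Theorem 1 with the explicit threshold `ε₀ ≥ 1/absEval`) and
`TameGrowth` (item 23474, growth lemma for the Hrubeš radius).  No tag, no rung changes
(LADDER-Valiant rung 0; VP ≠ VNP is not proved by anything here).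

The chain (all elementary logic over the items):
* node T `PerNotTame` ⟸ `SensitiveHardPoly ∧ QuantHrubesPer` — sensitive monotone hardness at the rate
  `ε = 2^-(n^C+C)`, pushed through the quantitative Hrubeš simulation, is a lower bound `absEval > 2^(n^C+C)`
  against TAME fan-in-two real circuits for `per_n` (Hrubeš 2020, Thm 1);
* `TamePer` ⟸ `SmallConstPer ∧ TameGrowth` — small constants and polynomial formal degree give
  single-exponential radius, the exponent `(n^C+C+1)(n^C+C)(s n+2)` being p-bounded;
* `S` ⟸ `PerNotTame ∧ TamePer` through realification `per ∈ VP_ℂ ⟹ per ∈ VP_ℝ`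
  (Hrubeš–Yehudayoff 2011 Thm 4.2, tree `…SymmetroidDescartes.isPComputable_perPoly_real_of_complex`) and
  `per ∉ VP_ℂ ↔ VP_ℂ ≠ VNP_ℂ` (Bürgisser 2000 Rem. 2.11, tree `perNotPComputableComplex_iff_holds`).
-/

set_option linter.dupNamespace false

namespace Summit.ValiantsHypothesis.ValiantsHypothesis.Theorems.TameSensitivityAssembly

open MvPolynomial Literature.Computability.AlgebraicComplexity
open Summit.ValiantsHypothesis.ValiantsHypothesis.Theses.TameSensitivity

/-- Node T (`PerNotTame`, inlined — it is not an item of this route): ε-sensitive monotone hardness of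
`per` at every single-exponential rate (`SensitiveHardPoly`) plus the quantitative Hrubeš simulation
(`QuantHrubesPer`) force every p-size fan-in-two real circuit for `per_n` to have absolute-value
evaluation at the all-ones point `> 2^(n^C+C)`, infinitely often. [cite: Hrubes2020, Thm 1] -/
theorem perNotTame_of_sensitive (hA : SensitiveHardPoly) (hQ : QuantHrubesPer) :
    ∀ (C : ℕ) (s : ℕ → ℕ), IsPBounded s →
      ∃ n : ℕ, ∀ P : ArithCircuit ℝ (Fin n × Fin n),
        P.IsFanInTwo → P.Computes (perPoly (Fin n) ℝ) → P.size ≤ s n →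
          (2 : ℝ) ^ (n ^ C + C) <
            MvPolynomial.eval (fun _ => (1 : ℝ)) (P.mapConsts (fun c : ℝ => |c|)).eval := by
  intro C s hs
  obtain ⟨t, ht, hH⟩ := hQ
  obtain ⟨n, hn⟩ := hA C (fun n => t n (s n)) (ht s hs)
  refine ⟨n, fun P hfan hcomp hsize => ?_⟩
  by_contra hle
  push Not at hle
  have hpow : (0 : ℝ) < (2 : ℝ) ^ (n ^ C + C) := pow_pos two_pos _
  have hr0 : (0 : ℝ) < ((2 : ℝ) ^ (n ^ C + C))⁻¹ := inv_pos.mpr hpow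
  have hr1 : ((2 : ℝ) ^ (n ^ C + C))⁻¹ ≤ 1 := inv_le_one_of_one_le₀ (one_le_pow₀ (by norm_num))
  refine hn _ le_rfl hr1 (hH n P (s n) hfan hcomp hsize _ hr0 hr1 ?_)
  calc ((2 : ℝ) ^ (n ^ C + C))⁻¹ *
        MvPolynomial.eval (fun _ => (1 : ℝ)) (P.mapConsts (fun c : ℝ => |c|)).eval
      ≤ ((2 : ℝ) ^ (n ^ C + C))⁻¹ * (2 : ℝ) ^ (n ^ C + C) := mul_le_mul_of_nonneg_left hle hr0.le
    _ = 1 := inv_mul_cancel₀ (pow_ne_zero _ two_ne_zero)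

/-- `TamePer` ⟸ `SmallConstPer ∧ TameGrowth` (inlined): under collapse, small constants (`≤ 2^(n^C+C)`)
and polynomial formal degree give fan-in-two circuits for `per_n` of single-exponential Hrubeš radius,
`absEval ≤ 2^(n^c'+c')`, since `(n^C+C+1)(n^C+C)(s n+2)` is p-bounded. [cite: Burgisser2000, Def. 2.1] -/
theorem tamePer_of_smallConst_growth (hS : SmallConstPer) (hG : TameGrowth) :
    IsPComputable (fun n => perPoly (Fin n) ℝ) →
      ∃ (C : ℕ) (s : ℕ → ℕ), IsPBounded s ∧
        ∀ n : ℕ, ∃ P : ArithCircuit ℝ (Fin n × Fin n),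
          P.IsFanInTwo ∧ P.Computes (perPoly (Fin n) ℝ) ∧ P.size ≤ s n ∧
            MvPolynomial.eval (fun _ => (1 : ℝ)) (P.mapConsts (fun c : ℝ => |c|)).eval ≤
              (2 : ℝ) ^ (n ^ C + C) := by
  intro hVP
  obtain ⟨C, s, hs, hP⟩ := hS hVP
  have he : IsPBounded fun n => (n ^ C + C + 1) * (n ^ C + C) * (s n + 2) :=
    IsPBounded.mul_holds
      (IsPBounded.mul_holds
        (IsPBounded.add_holds (IsPBounded.add_holds (IsPBounded.pow_holds IsPBounded.id C)
          (IsPBounded.const C)) (IsPBounded.const 1))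
        (IsPBounded.add_holds (IsPBounded.pow_holds IsPBounded.id C) (IsPBounded.const C)))
      (IsPBounded.add_holds hs (IsPBounded.const 2))
  obtain ⟨c', hc'⟩ := he
  refine ⟨c', s, hs, fun n => ?_⟩
  obtain ⟨P, hfan, hfan1, hcomp, hsize, hconst, hdeg, hdegout⟩ := hP n
  refine ⟨P, hfan, hcomp, hsize, ?_⟩
  calc MvPolynomial.eval (fun _ => (1 : ℝ)) (P.mapConsts (fun c : ℝ => |c|)).eval
      ≤ (2 : ℝ) ^ ((n ^ C + C + 1) * (n ^ C + C) * (P.size + 2)) :=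
        hG n (n ^ C + C) (n ^ C + C) P hfan hfan1 hconst hdeg hdegout
    _ ≤ (2 : ℝ) ^ ((n ^ C + C + 1) * (n ^ C + C) * (s n + 2)) := by
        gcongr
        · norm_num
    _ ≤ (2 : ℝ) ^ (n ^ c' + c') := by
        gcongr
        · norm_num
        · exact hc' n

/-- **Item 23475 (`TameSensitivity.Assembly`) holds**:
`SensitiveHardPoly → QuantHrubesPer → SmallConstPer → TameGrowth → VP_ℂ ≠ VNP_ℂ`.  If `VP_ℂ = VNP_ℂ`
then `per ∈ VP_ℂ`, hence `per ∈ VP_ℝ` (realification), hence by `TamePer` tame p-size circuits for `per_n`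
exist for all `n` — contradicting node T at the `n` it provides. [cite: Hrubes2020, Thm 1] -/
theorem assembly_holds :
    Summit.ValiantsHypothesis.ValiantsHypothesis.Theses.TameSensitivity.Assembly := by
  intro hA hQ hS hG
  have hN := perNotTame_of_sensitive hA hQ
  have hT := tamePer_of_smallConst_growth hS hG
  refine Literature.Computability.AlgebraicComplexity.perNotPComputableComplex_iff_holds.mp ?_
  intro hC
  have hVP :=
    Summit.ValiantsHypothesis.ValiantsHypothesis.Theorems.SymmetroidDescartes.isPComputable_perPoly_real_of_complex
      hC
  obtain ⟨C, s, hs, hP⟩ := hT hVP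
  obtain ⟨n, hn⟩ := hN C s hs
  obtain ⟨P, hfan, hcomp, hsize, habs⟩ := hP n
  exact absurd habs (not_le_of_gt (hn P hfan hcomp hsize))

end Summit.ValiantsHypothesis.ValiantsHypothesis.Theorems.TameSensitivityAssembly
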